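import Summits.Ventures.CertifiedManyBodySolver.Theorems.R2cStripStackTransport
import Summits.Ventures.CertifiedManyBodySolver.HubbardAlg.MbsolverRungLeaves
import HarnessLib

/-!
# R2c — seam-stack family TURNKEYS at filling `7/8` (row + the two upper leaves), def-free

HONEST FRAMING: first certified bounds; not a superconductivity verdict; every number certified or labelled float.
No energy is asserted here: every theorem takes the printed all-`m` / all-`k` seam-STACK family sentence as a hypothesis
(`hfam`, the shape of `Theorems.energyDensityTT'_le_of_stripStackFamily_all_rat`, = FORMAT `bd-strip-seam-v1` §2 (L5) FINITE FAMILY: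
`cc := c_W + Γ_outer` (or `c_cell + Γ_L`), `σ := B_drs − cc`, `B m := m·(2z + Γ_inter) + (m−1)·(4·Σ|c| + 16 + 2Γ_L)`, `q m := m·(q_max − q_min)`;
the kernel keeps `B q : ℕ → ℚ` arbitrary) and returns, at `t′ = 0`, `U = 8`, filling `Q_c/(cW) = 7/8`:
* `m3_tp0_upperRow_of_stripStackFamily_all_sevenEighths` — the ROW `M3EnergyUpperRow 0 ((cc + σ)/(c·W))` (m-free endpoint `B_drs/N`);
* `m3Upper_tp0_le_m18o25_of_stripStackFamily_all_sevenEighths` — the R2c LEAF (`closes` target of route `R2cOpenStripTangentLine`)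
  when `(cc + σ)/(c·W) ≤ −18/25`;
* `m3Upper_tp0_le_RS_of_stripStackFamily_all_sevenEighths` — the RS leaf when `(cc + σ)/(c·W) ≤ −12525490015723/2⁴⁴`;
* `…_glideW4Stack` specialisations (`c = 16`, `W = 4`, `Q_c = 56`; bar `cc + σ ≤ −1152/25` per 64-site period) = the S3/S4 objects
  («PLAQ-SEAM-W4», var-1 HOME/INBOX l.22730; eng-1 SEAM-CERT2 j276048).
A certificate node is then ONE `exact` with its printed literals (`by norm_num` for the bar), instead of the ≤ 60-line template
`R2c-bc3/StripStackClaimNode_S4_example.lean`. Companion of `R2cFamilyBelowLineClosures` § 4 (open-box / all-k / spin-cert turnkeys) and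
`R2cStripCellSectorConsumers.m3Upper_tp0_le_m18o25_of_exists_stripCellCert` (single strip cell).
-/

noncomputable section

open Matrix Finset
open scoped ComplexOrder BigOperators

namespace Summit.Ventures.CertifiedManyBodySolver.Theorems

open Literature.MathematicalPhysics.QuantumLattice
open Literature.MathematicalPhysics.QuantumLattice.ThermodynamicLimit
open Summit.Ventures.CertifiedManyBodySolver.MbsolverRungLeaves

/-- **ROW from an all-`m` seam-stack family at filling `7/8`** (`t′ = 0`, `U = 8`; any cell `c × W` with `8·Q_c = 7·c·W`):
`e₀(1,0,8; 7/8) ≤ (cc + σ)/(c·W)`. [folklore] -/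
theorem m3_tp0_upperRow_of_stripStackFamily_all_sevenEighths {c W : ℕ} (hc : 1 ≤ c) (hW : 1 ≤ W) {Qc : ℤ}
    (hfill : 8 * Qc = 7 * ((c : ℤ) * (W : ℤ))) (cc σ : ℚ) (B q : ℕ → ℚ)
    (hfam : ∀ m : ℕ, 1 ≤ m → ∀ k : ℕ, 1 ≤ k → ∃ n : ℕ, ∃ ψ : Fin n → Fock (Orb (Fin (k * c) ×ₗ Fin (m * W))),
      ∑ l, (star (ψ l) ⬝ᵥ ψ l).re = 1 ∧
      ∑ l, (star (ψ l) ⬝ᵥ (hubbardOpenBoxTT' (k * c) (m * W) 1 0 8 *ᵥ ψ l)).re ≤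
        ((((k : ℚ) * ((m : ℚ) * cc + ((m : ℚ) - 1) * σ) + B m : ℚ)) : ℝ) ∧
      ((((k : ℚ) * ((m : ℚ) * (Qc : ℚ)) - q m : ℚ)) : ℝ) ≤ ∑ l, (star (ψ l) ⬝ᵥ (totalNumber *ᵥ ψ l)).re ∧
      ∑ l, (star (ψ l) ⬝ᵥ (totalNumber *ᵥ ψ l)).re ≤ ((((k : ℚ) * ((m : ℚ) * (Qc : ℚ)) + q m : ℚ)) : ℝ)) :
    M3EnergyUpperRow 0 ((cc + σ) / ((c : ℚ) * (W : ℚ))) := by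
  unfold M3EnergyUpperRow
  have hcW1 : (1 : ℤ) ≤ (c : ℤ) * (W : ℤ) := by
    have h := Nat.mul_le_mul hc hW
    simp only [Nat.one_mul] at h
    exact_mod_cast h
  have hQ0 : 0 < Qc := by linarith
  have hQ2 : Qc < 2 * ((c : ℤ) * (W : ℤ)) := by linarith
  have h := energyDensityTT'_le_of_stripStackFamily_all_rat 1 0 (U := 8) (by norm_num) hc hW hQ0 hQ2 cc σ B q hfam
  have hcWpos : (0 : ℝ) < (c : ℝ) * (W : ℝ) := by
    have hc' : (0 : ℝ) < (c : ℝ) := by exact_mod_cast (lt_of_lt_of_le Nat.zero_lt_one hc)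
    have hW' : (0 : ℝ) < (W : ℝ) := by exact_mod_cast (lt_of_lt_of_le Nat.zero_lt_one hW)
    exact mul_pos hc' hW'
  have hn : ((Qc : ℤ) : ℝ) / ((c : ℝ) * (W : ℝ)) = 7 / 8 := by
    rw [div_eq_iff hcWpos.ne']
    have h8 : (8 : ℝ) * ((Qc : ℤ) : ℝ) = 7 * ((c : ℝ) * (W : ℝ)) := by exact_mod_cast hfill
    linarith
  rw [hn] at h
  exact h

/-- **The R2c LEAF** `MbsolverRungLeaves.M3Upper_tp0_le_m18o25` (= the `closes` conclusion of route `R2cOpenStripTangentLine`)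
from an all-`m` seam-stack family at `7/8` whose m-free endpoint meets the bar `(cc + σ)/(c·W) ≤ −18/25`. [folklore] -/
theorem m3Upper_tp0_le_m18o25_of_stripStackFamily_all_sevenEighths {c W : ℕ} (hc : 1 ≤ c) (hW : 1 ≤ W) {Qc : ℤ}
    (hfill : 8 * Qc = 7 * ((c : ℤ) * (W : ℤ))) (cc σ : ℚ) (B q : ℕ → ℚ)
    (hbar : (cc + σ) / ((c : ℚ) * (W : ℚ)) ≤ -18 / 25)
    (hfam : ∀ m : ℕ, 1 ≤ m → ∀ k : ℕ, 1 ≤ k → ∃ n : ℕ, ∃ ψ : Fin n → Fock (Orb (Fin (k * c) ×ₗ Fin (m * W))),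
      ∑ l, (star (ψ l) ⬝ᵥ ψ l).re = 1 ∧
      ∑ l, (star (ψ l) ⬝ᵥ (hubbardOpenBoxTT' (k * c) (m * W) 1 0 8 *ᵥ ψ l)).re ≤
        ((((k : ℚ) * ((m : ℚ) * cc + ((m : ℚ) - 1) * σ) + B m : ℚ)) : ℝ) ∧
      ((((k : ℚ) * ((m : ℚ) * (Qc : ℚ)) - q m : ℚ)) : ℝ) ≤ ∑ l, (star (ψ l) ⬝ᵥ (totalNumber *ᵥ ψ l)).re ∧
      ∑ l, (star (ψ l) ⬝ᵥ (totalNumber *ᵥ ψ l)).re ≤ ((((k : ℚ) * ((m : ℚ) * (Qc : ℚ)) + q m : ℚ)) : ℝ)) :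
    M3Upper_tp0_le_m18o25 :=
  ⟨(cc + σ) / ((c : ℚ) * (W : ℚ)), hbar, m3_tp0_upperRow_of_stripStackFamily_all_sevenEighths hc hW hfill cc σ B q hfam⟩

/-- **The RS leaf** `MbsolverRungLeaves.M3Upper_tp0_le_RS` from the same family when
`(cc + σ)/(c·W) ≤ −12525490015723/2⁴⁴` (= −0.7119916754…, CERTIFIED #524). [folklore] -/
theorem m3Upper_tp0_le_RS_of_stripStackFamily_all_sevenEighths {c W : ℕ} (hc : 1 ≤ c) (hW : 1 ≤ W) {Qc : ℤ}
    (hfill : 8 * Qc = 7 * ((c : ℤ) * (W : ℤ))) (cc σ : ℚ) (B q : ℕ → ℚ)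
    (hbar : (cc + σ) / ((c : ℚ) * (W : ℚ)) ≤ -12525490015723 / 17592186044416)
    (hfam : ∀ m : ℕ, 1 ≤ m → ∀ k : ℕ, 1 ≤ k → ∃ n : ℕ, ∃ ψ : Fin n → Fock (Orb (Fin (k * c) ×ₗ Fin (m * W))),
      ∑ l, (star (ψ l) ⬝ᵥ ψ l).re = 1 ∧
      ∑ l, (star (ψ l) ⬝ᵥ (hubbardOpenBoxTT' (k * c) (m * W) 1 0 8 *ᵥ ψ l)).re ≤
        ((((k : ℚ) * ((m : ℚ) * cc + ((m : ℚ) - 1) * σ) + B m : ℚ)) : ℝ) ∧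
      ((((k : ℚ) * ((m : ℚ) * (Qc : ℚ)) - q m : ℚ)) : ℝ) ≤ ∑ l, (star (ψ l) ⬝ᵥ (totalNumber *ᵥ ψ l)).re ∧
      ∑ l, (star (ψ l) ⬝ᵥ (totalNumber *ᵥ ψ l)).re ≤ ((((k : ℚ) * ((m : ℚ) * (Qc : ℚ)) + q m : ℚ)) : ℝ)) :
    M3Upper_tp0_le_RS :=
  ⟨(cc + σ) / ((c : ℚ) * (W : ℚ)), hbar, m3_tp0_upperRow_of_stripStackFamily_all_sevenEighths hc hW hfill cc σ B q hfam⟩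

/-! ## The W = 4 glide stack (S3 vertical-pair seams / S4 2×2-plaquette seams): `c = 16`, `W = 4`, `Q_c = 56`, 64-site period -/

/-- **ROW for the W = 4 glide stack**: `e₀(1,0,8; 7/8) ≤ (cc + σ)/64`. [folklore] -/
theorem m3_tp0_upperRow_of_glideW4Stack (cc σ : ℚ) (B q : ℕ → ℚ)
    (hfam : ∀ m : ℕ, 1 ≤ m → ∀ k : ℕ, 1 ≤ k → ∃ n : ℕ, ∃ ψ : Fin n → Fock (Orb (Fin (k * 16) ×ₗ Fin (m * 4))),
      ∑ l, (star (ψ l) ⬝ᵥ ψ l).re = 1 ∧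
      ∑ l, (star (ψ l) ⬝ᵥ (hubbardOpenBoxTT' (k * 16) (m * 4) 1 0 8 *ᵥ ψ l)).re ≤
        ((((k : ℚ) * ((m : ℚ) * cc + ((m : ℚ) - 1) * σ) + B m : ℚ)) : ℝ) ∧
      ((((k : ℚ) * ((m : ℚ) * (56 : ℚ)) - q m : ℚ)) : ℝ) ≤ ∑ l, (star (ψ l) ⬝ᵥ (totalNumber *ᵥ ψ l)).re ∧
      ∑ l, (star (ψ l) ⬝ᵥ (totalNumber *ᵥ ψ l)).re ≤ ((((k : ℚ) * ((m : ℚ) * (56 : ℚ)) + q m : ℚ)) : ℝ)) :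
    M3EnergyUpperRow 0 ((cc + σ) / 64) := by
  have h := m3_tp0_upperRow_of_stripStackFamily_all_sevenEighths (c := 16) (W := 4) (by norm_num) (by norm_num)
    (Qc := 56) (by norm_num) cc σ B q (fun m hm k hk => by
      obtain ⟨n, ψ, hS, hE, hNlo, hNhi⟩ := hfam m hm k hk
      exact ⟨n, ψ, hS, hE, by simpa using hNlo, by simpa using hNhi⟩)
  have h64 : ((cc + σ) / (((16 : ℕ) : ℚ) * ((4 : ℕ) : ℚ)) : ℚ) = (cc + σ) / 64 := by norm_num
  rw [h64] at h
  exact h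

/-- **R2c LEAF for the W = 4 glide stack**: bar `cc + σ ≤ −1152/25` (= −46.08 per 64-site period, i.e. ≤ −18/25 per site). [folklore] -/
theorem m3Upper_tp0_le_m18o25_of_glideW4Stack (cc σ : ℚ) (B q : ℕ → ℚ) (hbar : cc + σ ≤ -1152 / 25)
    (hfam : ∀ m : ℕ, 1 ≤ m → ∀ k : ℕ, 1 ≤ k → ∃ n : ℕ, ∃ ψ : Fin n → Fock (Orb (Fin (k * 16) ×ₗ Fin (m * 4))),
      ∑ l, (star (ψ l) ⬝ᵥ ψ l).re = 1 ∧
      ∑ l, (star (ψ l) ⬝ᵥ (hubbardOpenBoxTT' (k * 16) (m * 4) 1 0 8 *ᵥ ψ l)).re ≤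
        ((((k : ℚ) * ((m : ℚ) * cc + ((m : ℚ) - 1) * σ) + B m : ℚ)) : ℝ) ∧
      ((((k : ℚ) * ((m : ℚ) * (56 : ℚ)) - q m : ℚ)) : ℝ) ≤ ∑ l, (star (ψ l) ⬝ᵥ (totalNumber *ᵥ ψ l)).re ∧
      ∑ l, (star (ψ l) ⬝ᵥ (totalNumber *ᵥ ψ l)).re ≤ ((((k : ℚ) * ((m : ℚ) * (56 : ℚ)) + q m : ℚ)) : ℝ)) :
    M3Upper_tp0_le_m18o25 :=
  ⟨(cc + σ) / 64, by linarith, m3_tp0_upperRow_of_glideW4Stack cc σ B q hfam⟩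

/-- **RS leaf for the W = 4 glide stack**: bar `cc + σ ≤ −12525490015723/274877906944` (= 64 × (−0.7119916754…) = −45.567…
per period). S3's forecast ≈ −45.86/period [FLOAT] is of this class (no new leaf: `M3Upper_tp0_le_RS` is already closed by #524's row). [folklore] -/
theorem m3Upper_tp0_le_RS_of_glideW4Stack (cc σ : ℚ) (B q : ℕ → ℚ) (hbar : cc + σ ≤ -12525490015723 / 274877906944)
    (hfam : ∀ m : ℕ, 1 ≤ m → ∀ k : ℕ, 1 ≤ k → ∃ n : ℕ, ∃ ψ : Fin n → Fock (Orb (Fin (k * 16) ×ₗ Fin (m * 4))),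
      ∑ l, (star (ψ l) ⬝ᵥ ψ l).re = 1 ∧
      ∑ l, (star (ψ l) ⬝ᵥ (hubbardOpenBoxTT' (k * 16) (m * 4) 1 0 8 *ᵥ ψ l)).re ≤
        ((((k : ℚ) * ((m : ℚ) * cc + ((m : ℚ) - 1) * σ) + B m : ℚ)) : ℝ) ∧
      ((((k : ℚ) * ((m : ℚ) * (56 : ℚ)) - q m : ℚ)) : ℝ) ≤ ∑ l, (star (ψ l) ⬝ᵥ (totalNumber *ᵥ ψ l)).re ∧
      ∑ l, (star (ψ l) ⬝ᵥ (totalNumber *ᵥ ψ l)).re ≤ ((((k : ℚ) * ((m : ℚ) * (56 : ℚ)) + q m : ℚ)) : ℝ)) :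
    M3Upper_tp0_le_RS :=
  ⟨(cc + σ) / 64, by linarith, m3_tp0_upperRow_of_glideW4Stack cc σ B q hfam⟩

/-! ## Bar arithmetic by value (no energy asserted) -/

/-- Per-period bars on the 64-site glide-stack period: R2c needs `cc + σ ≤ −46.08`, RS needs `≤ −45.567…`; the (L5) constants of
FORMAT `bd-strip-seam-v1` enter only through `cc + σ = B_drs` (the endpoint is `cc`-independent). [folklore] -/
theorem glideW4Stack_bars_by_value :
    (-1152 / 25 : ℚ) / 64 = -18 / 25 ∧
    (-12525490015723 / 274877906944 : ℚ) / 64 = -12525490015723 / 17592186044416 ∧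
    (-1152 / 25 : ℚ) < -12525490015723 / 274877906944 ∧
    (-12525490015723 / 274877906944 : ℚ) - (-1152 / 25) < 513 / 1000 := by
  refine ⟨by norm_num, by norm_num, by norm_num, by norm_num⟩

end Summit.Ventures.CertifiedManyBodySolver.Theorems

end
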